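import Literature.AlgebraicGeometry.HodgeTheory.CMTypeOfSemisimpleRationalAction
import HarnessLib

/-!
# A commuting family on `H¹` generating semisimple endomorphisms, with one Hodge type per joint eigencharacter, forces CM type

Family form of `CMTypeOfSemisimpleRationalAction` (`Jacobian.isOfCMType_of_forall_eigensystem_oneType_of_isSemisimple`:
`X/ℂ` smooth projective, `𝒥` an Albanese datum with `b₁(X(ℂ)) ≤ 2 dim J`, `act : R →ₐ[ℚ] End_ℚ H¹(X(ℂ); ℚ)` with `R`
commutative, every `act a` semisimple and every eigensystem `t : R →ₐ[ℚ] ℂ` of ONE Hodge type ⇒ `J = Alb X` is of CM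
type), in the shape in which Hecke algebras are given — by GENERATORS:

* `Jacobian.isOfCMType_of_adjoin_isSemisimple_of_oneType` — `T : κ → End_ℚ H¹(X(ℂ); ℚ)` pairwise commuting, every
  element of `ℚ[T k : k]` semisimple, and every JOINT EIGENCHARACTER `χ : κ → ℂ` of one Hodge type on `X` (all its joint
  eigenvectors of type `(1,0)`, or all of type `(0,1)`) ⇒ `𝒥.J` is of CM type (`R := ℚ[T k : k]` with Mathlib's
  commutative-ring structure `Algebra.isMulCommutative_adjoin`, `act := Subalgebra.val`; an eigensystem `t` of `ℚ[T k]`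
  restricts to the joint eigencharacter `k ↦ t (T k)`).

Motivating instance: `X = X_Γ` a compact Picard modular surface and `T` the Hecke operators on `H¹(X_Γ(ℂ); ℚ)` — «the
Albanese of a Picard modular surface is of CM type» (Murty–Ramakrishnan 1992) once every joint Hecke eigencharacter on
`H¹` carries one Hodge type; nothing automorphic is stated here.  Cell pub-hodgecm2, lane «L-BYPASS» (kernel text by the
seat pub-hodgecm2-s2crux-idea-2, probe `RA-v35` Part N §N.1, gen 8; filed by b10).  Theorems only; no named fact.

References: P. Deligne, *Hodge cycles on abelian varieties*, LNM 900 (1982), §4 and I §5 Prop. 5.1 (proof)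
[Deligne1982HodgeCycles]; V. K. Murty, D. Ramakrishnan, *The Albanese of unitary Shimura varieties*, in *The zeta
functions of Picard modular surfaces* (CRM Montréal, 1992), pp. 445–464 [MurtyRamakrishnan1992].
-/

noncomputable section

namespace Literature.AlgebraicGeometry.Motives

open CategoryTheory
open Literature.AlgebraicGeometry.HodgeTheory
open Literature.AlgebraicGeometry.Milne1999 (IsOfCMType)
open Literature.AlgebraicGeometry.ComplexMultiplication
open scoped TensorProduct

section FamilyCMType

variable {d : ℕ} {X : SchemeOver ℂ}

open scoped IsMulCommutative in
/-- **Family form of the CM step.** `X` smooth projective, `𝒥` an Albanese datum with `b₁(X(ℂ)) ≤ 2 dim J`,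
`T : κ → End_ℚ H¹(X(ℂ); ℚ)` a pairwise commuting family such that every element of the generated algebra `ℚ[T_k]` is
semisimple, and every joint eigencharacter `χ : κ → ℂ` of ONE Hodge type on `X` ⇒ `J = Alb X` is of CM type
(`Jacobian.isOfCMType_of_forall_eigensystem_oneType_of_isSemisimple` for `R := ℚ[T_k]`, commutative by
`Algebra.isMulCommutative_adjoin`). [cite: Deligne1982HodgeCycles, §4 and I §5 Prop. 5.1 (proof)]
[cite: MurtyRamakrishnan1992, pp. 445–464] -/
theorem Jacobian.isOfCMType_of_adjoin_isSemisimple_of_oneType (hX : IsSmoothProjective d X) (𝒥 : Jacobian X)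
    (P : AlgPoints X ℂ) (hAlb : Module.finrank ℚ (bettiCohomology X 1) ≤ 2 * 𝒥.J.dim) {κ : Type*}
    (T : κ → Module.End ℚ (bettiCohomology X 1)) (hc : ∀ k l, Commute (T k) (T l))
    (hss : ∀ a ∈ Algebra.adjoin ℚ (Set.range T), Module.End.IsSemisimple a)
    (htype : ∀ χ : κ → ℂ,
      (∀ w, (∀ k, (T k).baseChange ℂ w = χ k • w) →
        IsOfHodgeType d X 1 1 0 (ofRatClassBaseChange (ComplexPoints X) 1 w)) ∨
      (∀ w, (∀ k, (T k).baseChange ℂ w = χ k • w) →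
        IsOfHodgeType d X 1 0 1 (ofRatClassBaseChange (ComplexPoints X) 1 w))) :
    IsOfCMType 𝒥.J := by
  haveI := Algebra.isMulCommutative_adjoin ℚ (s := Set.range T)
    (by rintro _ ⟨k, rfl⟩ _ ⟨l, rfl⟩; exact (hc k l).eq)
  refine Jacobian.isOfCMType_of_forall_eigensystem_oneType_of_isSemisimple hX 𝒥 P hAlb
    (Algebra.adjoin ℚ (Set.range T)).val (fun a => hss a a.2) fun t => ?_
  have key : ∀ w : ℂ ⊗[ℚ] bettiCohomology X 1,
      (∀ a, ((Algebra.adjoin ℚ (Set.range T)).val a).baseChange ℂ w = t a • w) →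
        ∀ k, (T k).baseChange ℂ w = t ⟨T k, Algebra.subset_adjoin ⟨k, rfl⟩⟩ • w :=
    fun w hw k => hw ⟨T k, Algebra.subset_adjoin ⟨k, rfl⟩⟩
  rcases htype (fun k => t ⟨T k, Algebra.subset_adjoin ⟨k, rfl⟩⟩) with h10 | h01
  · exact Or.inl fun w hw => h10 w (key w hw)
  · exact Or.inr fun w hw => h01 w (key w hw)

end FamilyCMType

end Literature.AlgebraicGeometry.Motives

end
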